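import Mathlib
import HarnessLib
import Literature.MathematicalPhysics.QuantumLattice.GrassmannDeepPinGradedLipschitz
import Literature.MathematicalPhysics.QuantumLattice.GrassmannEffectiveActionRepresentation
import Literature.MathematicalPhysics.QuantumLattice.GrassmannLinearSubstitution
import Summits.HubbardSuperconductivity.HubbardSuperconductivity.Theorems.KLProgrammeKLRegimeTwoVolumeSubstitutionPushforward

/-!
# Route `KLProgramme` — crux K3 ENGINE (stmt-HubbardSuperconductivity-20437), stub (e) proof-input «(e)-D-ROWS», (M3): THE TWO-VOLUME LIPSCHITZ BLOCK STEP
# AT A DEEP PIN, `(f, g)`-READING — orders `≥ 2` of the increment difference, substituted input and substituted output (seat hubbard-kl-k3c4-p1 g22;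
# `--supports` 20437; DROWS-SCOPE-g22 §7.2, §8.1)

The generic heart of the (M3) block step of the two-volume (Lipschitz) tower, in the reading the engine's plateau doors use
(`Lit/SectorisedIncrementBoundGradedLipschitzPlateau` §1): the inputs `V` (glued coarse analysed action) and `V + D` (fine analysed action) live on the INPUT
labels `Γ′` (position × sector: the deep region `P ⊆ Γ′` and the tree weight `wt` live there), the Gaussian step runs on `Γ` at the covariance `C` after the
substitution `f` (so the doors see the pulled-back covariance `fᵀCf`, `Lit/GrassmannLinearSubstitution.effAction_map`), and the output is read through `g` at
ONE output pin `w″ ∈ Γ″` whose row of `h = g∘f` splits into a NEAR part (deep input pins, total `≤ a`) and a FAR tail (`≤ τ`).  On `Γ′` the difference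
`incr_{fᵀCf}(V+D) − incr_{fᵀCf}(V)` is deep-small by `Lit/GrassmannDeepPinGradedLipschitz` (support split + zone-free graded Lipschitz door + graded zone door,
`Λ` admissible at every near pin) and globally bounded by the zone-free door at the global difference profile; the pushforward
`…TwoVolumeSubstitutionPushforward.sum_pinned_norm_kernel_map_le_of_near` combines the two:

* **`sum_pinned_norm_kernel_map_incr_sub_incr_le_of_deep`** —
  `Σ_{X″ : X″_p = w″} ‖kernel_{r+1} (map g (incr_C(map f (V+D)) − incr_C(map f V)))(X″)‖ ≤ a^r·(a·(GL(N_V+N_D+E; E) + Λ⁻¹·GZ_Λ(N_V+N_D; N_D)) + τ·GL(N_V+N_D; N_D))`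
  with `incr_C X := effAction C X − e^{Δ_C}X` and `GL`, `GZ_Λ` the right sides of the graded Lipschitz / graded zone doors (product form on the leg
  constraint; kit readings `…EngineTowerDoorToKitLip`, `…TwoVolumeLipDoorToKit`).

NOT here: the first order (binomial doors, `Lit/GrassmannGaussConvBinomialZone` for the boundary part), the model dictionary (F-D3′: `f = S(F̃_{J_k−1})`,
`g = ε•E(F_{J′})`, `C` = the block covariance, `P` = the `r_k`-deep labels, `Near` = the `(r_k+ρ_k)`-deep labels, `Λ = 1 + Λ_{J_{k+1}}(ρ_k+1)` by
`…TwoVolumeLipZoneGeometry`).  Everything is proved; no definition.  Nothing about the model is asserted; nothing asserts the (D) rows, stub (e), VL, K3 or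
superconductivity.  References: BGM 2006 (2.61)–(2.63), (2.77)–(2.90), §3 [cite: BenfattoGiulianiMastropietro2006]; Gawȩdzki–Kupiainen 1985 §3.
-/

noncomputable section

namespace Summit.HubbardSuperconductivity.HubbardSuperconductivity.Theorems.TwoVolumeDefect

set_option linter.dupNamespace false -- summit = problem name (single-conjunct summit), D-0017

open Finset Literature.MathematicalPhysics.QuantumLattice GrassmannAlgebra Literature.Probability.LatticeModels
  Literature.Probability.LatticeModels.BattleFederbush

universe u

variable {𝕜 : Type*} [RCLike 𝕜]

/-- The right side of the zone-free graded Lipschitz door is nonnegative (`0 ≤ μ, ν`, `θ = eα‖μ‖_h/κ² < 1`). -/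
theorem gradedLipRHS_nonneg (Γ : Type u) [Fintype Γ] {κ ρ α : ℝ} (hκ : 0 < κ) (hρ : 0 < ρ) (hα : 0 ≤ α) {μ ν : ℕ → ℝ}
    (hμ0 : ∀ m', 0 ≤ μ m') (hν0 : ∀ m', 0 ≤ ν m') (hθ : Real.exp 1 * α * normV Γ κ ρ μ / κ ^ 2 < 1) {c : ℝ} (hc : 0 ≤ c) (N₀ m : ℕ) :
    0 ≤ ∑ n ∈ Ico 2 N₀, (ρ⁻¹ ^ m * κ⁻¹ ^ (2 * (n - 1)) * (α ^ (n - 1) * Real.exp n)) *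
          ∑ δ ∈ (Fintype.piFinset fun _ : Fin n => range (Fintype.card Γ / 2 + 1)) with m + 2 * (n - 1) ≤ ∑ a, 2 * δ a,
            ∑ a, (Real.exp 2 * (κ + ρ)) ^ (2 * δ a) * ν (δ a) * ∏ b ∈ univ.erase a, (Real.exp 2 * (κ + ρ)) ^ (2 * δ b) * μ (δ b) +
        c * (2 * (ρ⁻¹ ^ m * (Real.exp 1 * normV Γ κ ρ μ) *
          (Real.exp 1 * α * normV Γ κ ρ μ / κ ^ 2) ^ (N₀ - 1) / (1 - Real.exp 1 * α * normV Γ κ ρ μ / κ ^ 2))) := by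
  have hτ0 : 0 ≤ Real.exp 2 * (κ + ρ) := mul_nonneg (Real.exp_pos _).le (add_nonneg hκ.le hρ.le)
  have hV0 : 0 ≤ normV Γ κ ρ μ := normV_nonneg hκ.le hρ.le hμ0
  have hθ0 : 0 ≤ Real.exp 1 * α * normV Γ κ ρ μ / κ ^ 2 := by positivity
  refine add_nonneg (sum_nonneg fun n _ => mul_nonneg (by positivity) (sum_nonneg fun δ _ => sum_nonneg fun a _ => ?_)) ?_
  · exact mul_nonneg (mul_nonneg (pow_nonneg hτ0 _) (hν0 _)) (prod_nonneg fun b _ => mul_nonneg (pow_nonneg hτ0 _) (hμ0 _))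
  · exact mul_nonneg hc (mul_nonneg zero_le_two (div_nonneg (by positivity) (sub_nonneg.2 hθ.le)))

/-- **THE TWO-VOLUME LIPSCHITZ BLOCK STEP AT A DEEP PIN, `(f,g)`-READING (orders `≥ 2`).**  Labels: `Γ′` (inputs; tree weight `wt`, deep region `P`), `Γ`
(the covariance `C`), `Γ″` (outputs); substitutions `f : (Γ′ → 𝕜) →ₗ (Γ → 𝕜)`, `g : (Γ → 𝕜) →ₗ (Γ″ → 𝕜)`, `h = g ∘ f` with column sums `≤ a`, and at the
output pin `w″` a near part of its row (`Near ⊆ Γ′`, total `≤ a`) and a far tail `≤ τ`.  The pulled-back covariance `fᵀCf` is replica-Gram-bounded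
(constant `κ`) with `wt`-weighted row/column sums `≤ α`; `V`, `D` even without constant part on `Γ′` with `wt`-weighted pinned profiles `N_V`, `N_D` and the
UNWEIGHTED profile of `D` at the pins of `P` at most `E`; smallness `θ₁` (at `N_V+N_D+E`), `θ₂` (at `N_V+N_D`); `0 < Λ ≤ wt S` for every near pin `y′`,
every `S ∋ y′` meeting `Pᶜ`.  Then for every `N₀ ≥ 2` and output degree `r+1`, slot `p` pinned at `w″`:
`Σ_{X″ : X″_p = w″} ‖kernel_{r+1}(map g (incr_C(map f (V+D)) − incr_C(map f V)))(X″)‖ ≤ a^r·(a·(GL(N_V+N_D+E; E) + Λ⁻¹·GZ_Λ(N_V+N_D; N_D)) + τ·GL(N_V+N_D; N_D))`. -/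
theorem sum_pinned_norm_kernel_map_incr_sub_incr_le_of_deep
    {Γ : Type u} [Fintype Γ] [DecidableEq Γ] {Γ' : Type u} [Fintype Γ'] [DecidableEq Γ'] {Γ'' : Type*} [Fintype Γ''] [DecidableEq Γ'']
    {wt : Finset Γ' → ℝ} (hwt : IsTreeWeight wt) (C : Matrix Γ Γ 𝕜) (f : (Γ' → 𝕜) →ₗ[𝕜] (Γ → 𝕜)) (g : (Γ → 𝕜) →ₗ[𝕜] (Γ'' → 𝕜))
    {κ : ℝ} (hκ : 0 < κ) (hGB : IsGramBoundedR ((LinearMap.toMatrix' f).transpose * C * LinearMap.toMatrix' f) κ)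
    (V D : GrassmannAlgebra 𝕜 Γ') (hV : V ∈ evenPart 𝕜 Γ') (hD : D ∈ evenPart 𝕜 Γ') (hV0 : constPart 𝕜 V = 0) (hD0 : constPart 𝕜 D = 0)
    (NV ND E : ℕ → ℝ) (hNV0 : ∀ m', 0 ≤ NV m') (hND0 : ∀ m', 0 ≤ ND m') (hE0 : ∀ m', 0 ≤ E m')
    (hNV : ∀ m' (j : Fin (2 * m')) (x : Γ'), ∑ Y ∈ univ.filter (fun Y : Fin (2 * m') → Γ' => Y j = x),
      ‖kernel 𝕜 V (2 * m') Y‖ * wt (univ.image Y) ≤ NV m')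
    (hND : ∀ m' (j : Fin (2 * m')) (x : Γ'), ∑ Y ∈ univ.filter (fun Y : Fin (2 * m') → Γ' => Y j = x),
      ‖kernel 𝕜 D (2 * m') Y‖ * wt (univ.image Y) ≤ ND m')
    (P : Γ' → Prop) [DecidablePred P]
    (hE : ∀ m' (j : Fin (2 * m')) (x : Γ'), P x → ∑ Y ∈ univ.filter (fun Y : Fin (2 * m') → Γ' => Y j = x), ‖kernel 𝕜 D (2 * m') Y‖ ≤ E m')
    {α : ℝ} (hα : 0 < α)
    (hrow : ∀ X, ∑ Y, ‖((LinearMap.toMatrix' f).transpose * C * LinearMap.toMatrix' f) X Y‖ * wt {X, Y} ≤ α)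
    (hcol : ∀ Y, ∑ X, ‖((LinearMap.toMatrix' f).transpose * C * LinearMap.toMatrix' f) X Y‖ * wt {X, Y} ≤ α)
    {ρ : ℝ} (hρ : 0 < ρ)
    (hθ₁ : Real.exp 1 * α * normV Γ' κ ρ (fun m' => NV m' + ND m' + E m') / κ ^ 2 < 1)
    (hθ₂ : Real.exp 1 * α * normV Γ' κ ρ (fun m' => NV m' + ND m') / κ ^ 2 < 1)
    {N₀ : ℕ} (hN₀ : 2 ≤ N₀)
    -- the substitution `h = g ∘ f` at the output pin
    (Near : Γ' → Prop) [DecidablePred Near] {a τ : ℝ} (ha : 0 ≤ a)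
    (hcolH : ∀ y', ∑ x'', ‖LinearMap.toMatrix' (g ∘ₗ f) x'' y'‖ ≤ a) (w'' : Γ'')
    (hrowH : ∑ y' ∈ univ.filter (fun y' : Γ' => Near y'), ‖LinearMap.toMatrix' (g ∘ₗ f) w'' y'‖ ≤ a)
    (hτH : ∑ y' ∈ univ.filter (fun y' : Γ' => ¬ Near y'), ‖LinearMap.toMatrix' (g ∘ₗ f) w'' y'‖ ≤ τ)
    {Λ : ℝ} (hΛ0 : 0 < Λ) (hΛ : ∀ y', Near y' → ∀ S : Finset Γ', y' ∈ S → (∃ z ∈ S, ¬ P z) → Λ ≤ wt S)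
    {r : ℕ} (p : Fin (r + 1)) :
    ∑ X'' ∈ univ.filter (fun X'' : Fin (r + 1) → Γ'' => X'' p = w''),
        ‖kernel 𝕜 (ExteriorAlgebra.map g
          ((effAction 𝕜 C (ExteriorAlgebra.map f (V + D)) - gaussConv 𝕜 C (ExteriorAlgebra.map f (V + D))) -
            (effAction 𝕜 C (ExteriorAlgebra.map f V) - gaussConv 𝕜 C (ExteriorAlgebra.map f V)))) (r + 1) X''‖ ≤
      a ^ r * (a *
        ((∑ n ∈ Ico 2 N₀, (ρ⁻¹ ^ (r + 1) * κ⁻¹ ^ (2 * (n - 1)) * (α ^ (n - 1) * Real.exp n)) *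
            ∑ δ ∈ (Fintype.piFinset fun _ : Fin n => range (Fintype.card Γ' / 2 + 1)) with r + 1 + 2 * (n - 1) ≤ ∑ a, 2 * δ a,
              ∑ a, (Real.exp 2 * (κ + ρ)) ^ (2 * δ a) * E (δ a) *
                ∏ b ∈ univ.erase a, (Real.exp 2 * (κ + ρ)) ^ (2 * δ b) * (NV (δ b) + ND (δ b) + E (δ b)) +
          2 * (ρ⁻¹ ^ (r + 1) * (Real.exp 1 * normV Γ' κ ρ (fun m' => NV m' + ND m' + E m')) *
            (Real.exp 1 * α * normV Γ' κ ρ (fun m' => NV m' + ND m' + E m') / κ ^ 2) ^ (N₀ - 1) /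
              (1 - Real.exp 1 * α * normV Γ' κ ρ (fun m' => NV m' + ND m' + E m') / κ ^ 2))) +
        Λ⁻¹ * (∑ n ∈ Ico 2 N₀, (ρ⁻¹ ^ (r + 1) * κ⁻¹ ^ (2 * (n - 1)) * (α ^ (n - 1) * Real.exp n)) *
            ∑ δ ∈ (Fintype.piFinset fun _ : Fin n => range (Fintype.card Γ' / 2 + 1)) with r + 1 + 2 * (n - 1) ≤ ∑ a, 2 * δ a,
              ∑ a, (Real.exp 2 * (κ + ρ)) ^ (2 * δ a) * ND (δ a) *
                ∏ b ∈ univ.erase a, (Real.exp 2 * (κ + ρ)) ^ (2 * δ b) * (NV (δ b) + ND (δ b)) +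
          Λ * (2 * (ρ⁻¹ ^ (r + 1) * (Real.exp 1 * normV Γ' κ ρ (fun m' => NV m' + ND m')) *
            (Real.exp 1 * α * normV Γ' κ ρ (fun m' => NV m' + ND m') / κ ^ 2) ^ (N₀ - 1) /
              (1 - Real.exp 1 * α * normV Γ' κ ρ (fun m' => NV m' + ND m') / κ ^ 2))))) +
        τ * (∑ n ∈ Ico 2 N₀, (ρ⁻¹ ^ (r + 1) * κ⁻¹ ^ (2 * (n - 1)) * (α ^ (n - 1) * Real.exp n)) *
            ∑ δ ∈ (Fintype.piFinset fun _ : Fin n => range (Fintype.card Γ' / 2 + 1)) with r + 1 + 2 * (n - 1) ≤ ∑ a, 2 * δ a,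
              ∑ a, (Real.exp 2 * (κ + ρ)) ^ (2 * δ a) * ND (δ a) *
                ∏ b ∈ univ.erase a, (Real.exp 2 * (κ + ρ)) ^ (2 * δ b) * (NV (δ b) + ND (δ b)) +
          2 * (ρ⁻¹ ^ (r + 1) * (Real.exp 1 * normV Γ' κ ρ (fun m' => NV m' + ND m')) *
            (Real.exp 1 * α * normV Γ' κ ρ (fun m' => NV m' + ND m') / κ ^ 2) ^ (N₀ - 1) /
              (1 - Real.exp 1 * α * normV Γ' κ ρ (fun m' => NV m' + ND m') / κ ^ 2)))) := by
  set C' : Matrix Γ' Γ' 𝕜 := (LinearMap.toMatrix' f).transpose * C * LinearMap.toMatrix' f with hC'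
  -- the difference of the increments lives on `Γ′`
  set X : GrassmannAlgebra 𝕜 Γ' := (effAction 𝕜 C' (V + D) - gaussConv 𝕜 C' (V + D)) - (effAction 𝕜 C' V - gaussConv 𝕜 C' V) with hX
  have hsub : (effAction 𝕜 C (ExteriorAlgebra.map f (V + D)) - gaussConv 𝕜 C (ExteriorAlgebra.map f (V + D))) -
      (effAction 𝕜 C (ExteriorAlgebra.map f V) - gaussConv 𝕜 C (ExteriorAlgebra.map f V)) = ExteriorAlgebra.map f X := by
    rw [effAction_map 𝕜 f C (V + D), gaussConv_map 𝕜 f C (V + D), effAction_map 𝕜 f C V, gaussConv_map 𝕜 f C V, hX, map_sub, map_sub, map_sub]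
  have hmap : ExteriorAlgebra.map g (ExteriorAlgebra.map f X) = ExteriorAlgebra.map (Matrix.toLin' (LinearMap.toMatrix' (g ∘ₗ f))) X := by
    rw [map_map_eq_map_comp, Matrix.toLin'_toMatrix']
  rw [hsub, hmap]
  -- unweighted data on `Γ′`
  have hrowu : ∀ Xl, ∑ Y, ‖C' Xl Y‖ ≤ α := fun Xl =>
    (sum_le_sum fun Y _ => le_mul_of_one_le_right (norm_nonneg _) (hwt.one_le _)).trans (hrow Xl)
  have hcolu : ∀ Y, ∑ Xl, ‖C' Xl Y‖ ≤ α := fun Y =>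
    (sum_le_sum fun Xl _ => le_mul_of_one_le_right (norm_nonneg _) (hwt.one_le _)).trans (hcol Y)
  have hVu : ∀ m' (j : Fin (2 * m')) (x : Γ'), ∑ Y ∈ univ.filter (fun Y : Fin (2 * m') → Γ' => Y j = x),
      ‖kernel 𝕜 V (2 * m') Y‖ ≤ (fun m' => NV m' + ND m') m' := fun m' j x =>
    ((sum_le_sum fun _ _ => le_mul_of_one_le_right (norm_nonneg _) (hwt.one_le _)).trans (hNV m' j x)).trans (by have := hND0 m'; simp only; linarith)
  have hDu : ∀ m' (j : Fin (2 * m')) (x : Γ'), ∑ Y ∈ univ.filter (fun Y : Fin (2 * m') → Γ' => Y j = x), ‖kernel 𝕜 D (2 * m') Y‖ ≤ ND m' :=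
    fun m' j x => (sum_le_sum fun _ _ => le_mul_of_one_le_right (norm_nonneg _) (hwt.one_le _)).trans (hND m' j x)
  have hVDu : ∀ m' (j : Fin (2 * m')) (x : Γ'), ∑ Y ∈ univ.filter (fun Y : Fin (2 * m') → Γ' => Y j = x),
      ‖kernel 𝕜 (V + D) (2 * m') Y‖ ≤ (fun m' => NV m' + ND m') m' := by
    intro m' j x
    calc ∑ Y ∈ univ.filter (fun Y : Fin (2 * m') → Γ' => Y j = x), ‖kernel 𝕜 (V + D) (2 * m') Y‖
        ≤ ∑ Y ∈ univ.filter (fun Y : Fin (2 * m') → Γ' => Y j = x), (‖kernel 𝕜 V (2 * m') Y‖ * wt (univ.image Y) + ‖kernel 𝕜 D (2 * m') Y‖) := by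
          refine sum_le_sum fun Y _ => ?_
          rw [kernel_add]
          exact (norm_add_le _ _).trans (add_le_add (le_mul_of_one_le_right (norm_nonneg _) (hwt.one_le _)) le_rfl)
      _ ≤ NV m' + ND m' := by rw [sum_add_distrib]; exact add_le_add (hNV m' j x) (hDu m' j x)
  have hdiffu : ∀ m' (j : Fin (2 * m')) (x : Γ'), ∑ Y ∈ univ.filter (fun Y : Fin (2 * m') → Γ' => Y j = x),
      ‖kernel 𝕜 (V + D) (2 * m') Y - kernel 𝕜 V (2 * m') Y‖ ≤ ND m' := by
    intro m' j x
    refine le_trans (le_of_eq (sum_congr rfl fun Y _ => ?_)) (hDu m' j x)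
    rw [kernel_add, add_sub_cancel_left]
  have hVDe : V + D ∈ evenPart 𝕜 Γ' := add_mem hV hD
  have hVD0 : constPart 𝕜 (V + D) = 0 := by rw [map_add, hV0, hD0, add_zero]
  -- (global) the zone-free graded door at the global difference profile, every pin
  have hglob : ∀ y' : Γ', ∑ Y' ∈ univ.filter (fun Y' : Fin (r + 1) → Γ' => Y' p = y'), ‖kernel 𝕜 X (r + 1) Y'‖ ≤ _ :=
    fun y' => sum_norm_kernel_effAction_sub_gaussConv_sub_le_graded_of_gramBounded C' hκ hGB (V + D) V hVDe hV hVD0 hV0 (fun m' => NV m' + ND m') ND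
      (fun m' => add_nonneg (hNV0 m') (hND0 m')) hND0 hVDu hVu hdiffu hα hrowu hcolu hρ hθ₂ hN₀ (Nat.succ_pos r) p y'
  -- (deep) the support-split composition at every near pin
  have hdeep : ∀ y' : Γ', Near y' → ∑ Y' ∈ univ.filter (fun Y' : Fin (r + 1) → Γ' => Y' p = y'), ‖kernel 𝕜 X (r + 1) Y'‖ ≤ _ :=
    fun y' hy' => sum_norm_kernel_incr_sub_incr_le_graded_of_deep C' hwt hκ hGB V D hV hD hV0 hD0 NV ND E hNV0 hND0 hE0 hNV hND P hE hα hrow hcol hρ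
      hθ₁ hθ₂ hN₀ (Nat.succ_pos r) p y' hΛ0 (hΛ y' hy')
  -- nonnegativity of the two bounds
  have hEnn := add_nonneg (gradedLipRHS_nonneg Γ' hκ hρ hα.le (μ := fun m' => NV m' + ND m' + E m') (ν := E)
      (fun m' => add_nonneg (add_nonneg (hNV0 m') (hND0 m')) (hE0 m')) hE0 hθ₁ zero_le_one N₀ (r + 1))
    (mul_nonneg (inv_nonneg.2 hΛ0.le) (gradedLipRHS_nonneg Γ' hκ hρ hα.le (μ := fun m' => NV m' + ND m') (ν := ND)
      (fun m' => add_nonneg (hNV0 m') (hND0 m')) hND0 hθ₂ hΛ0.le N₀ (r + 1)))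
  have hNDnn := gradedLipRHS_nonneg Γ' hκ hρ hα.le (μ := fun m' => NV m' + ND m') (ν := ND)
    (fun m' => add_nonneg (hNV0 m') (hND0 m')) hND0 hθ₂ zero_le_one N₀ (r + 1)
  simp only [one_mul] at hEnn hNDnn
  -- pushforward through `h = g ∘ f` at the output pin
  have h := sum_pinned_norm_kernel_map_le_of_near (LinearMap.toMatrix' (g ∘ₗ f)) X p w'' Near ha hEnn hNDnn hcolH hrowH hτH hdeep hglob
  exact h

end Summit.HubbardSuperconductivity.HubbardSuperconductivity.Theorems.TwoVolumeDefect

end
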